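import Literature.Analysis.FluidPDE.BlowupAncientSolutionProofs
import Literature.Analysis.FluidPDE.KNSSTypeIIHolds
import Summits.NavierStokesRegularity.NavierStokesRegularity.Theorems.CertifiedBlowupCertifiedBlowupAxisymBlowupNormalForm
import Summits.NavierStokesRegularity.NavierStokesRegularity.Theorems.CertifiedBlowupCertifiedBlowupAxisymBlowupSwirlPersists
import HarnessLib

/-!
# The crux `CertifiedBlowupAxisymBlowup` generates a KNSS blow-up limit

Theorems file landed `--supports stmt-NavierStokesRegularity-0727`, line `compact-amplification`
(continuation lead c2; bet route `SwirlThreshold`). Route `SwirlThreshold`'s compactness crux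
`SwirlThresholdZoom` (stmt-2119) and route `TypeILiouville` both start from the KNSS zoom: "a
finite-time singularity arising from a mild solution generates a bounded ancient mild solution which
is not identically zero" (Koch–Nadirashvili–Seregin–Šverák 2009, Prop. 6.1 — a THEOREM of the tree,
`KNSS2009_blowup_generates_ancient_holds`). This file checks, in the kernel, that every witness of
the crux falls under the hypotheses of that proposition, and records the consequence:

* `exists_isKNSSBlowupLimit_of_isMaximalSmoothSolution_one` — a maximal Leray–Hopf classical
  solution of unit viscosity and finite lifespan from a rapidly decaying axisymmetric datum is the
  Kato mild solution from its datum (`isKatoSolutionOn_of_classical`), bounded on every earlier slab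
  (`bounded_before_of_lerayHopf_classical`) and unbounded on `[0, T) × ℝ³` (bounded Leray–Hopf
  classical solutions continue, `hasSmoothExtensionPast_of_bounded_holds`), so KNSS Prop. 6.1
  produces a KNSS blow-up limit `v` (`IsKNSSBlowupLimit`: a smooth bounded ancient mild solution,
  `ν = 1`, with `|v| ≤ 1 = sup |v|`);
* `exists_isKNSSBlowupLimit_of_certifiedBlowupAxisymBlowup` — with the landed normal form
  `certifiedBlowupAxisymBlowup_iff_forall_nu_T` (viscosity and lifespan are immaterial) the crux
  itself implies the existence of a KNSS blow-up limit (registered stub).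

What is NOT here (and is the open content of `SwirlThresholdZoom`): any symmetry or swirl
information on the limit — the zoom centres need not lie on the axis in rescaled units.

No new definitions, no named-fact hypotheses, no `sorry`.

## References

* G. Koch, N. Nadirashvili, G. Seregin, V. Šverák, Acta Math. 203 (2009), Prop. 6.1, (6.2)–(6.3).
  [KochNadirashviliSereginSverak2009]
-/

-- the summit and its single problem share the name (D-0017 nested layout)
set_option linter.dupNamespace false

noncomputable section

open MeasureTheory Set Function Filter Topology Metric
open scoped ENNReal NNReal

namespace Summit.NavierStokesRegularity.NavierStokesRegularity.Theorems.CertifiedBlowupAxisymBlowup.CompactAmplification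

open Literature.Analysis.FluidPDE
open Summit.NavierStokesRegularity.NavierStokesRegularity.Theses.CertifiedBlowup

/-- **A unit-viscosity witness generates a KNSS blow-up limit** (KNSS 2009, Prop. 6.1 applied to the
Kato mild solution from the datum: bounded on earlier slabs, unbounded on `[0, T) × ℝ³` by
maximality and the continuation of bounded Leray–Hopf classical solutions).
[cite: KochNadirashviliSereginSverak2009, Prop. 6.1] -/
theorem exists_isKNSSBlowupLimit_of_isMaximalSmoothSolution_one {T : ℝ}
    {u : ℝ → EuclideanSpace ℝ (Fin 3) → EuclideanSpace ℝ (Fin 3)} {p : ℝ → EuclideanSpace ℝ (Fin 3) → ℝ}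
    (hT : 0 < T) (hmax : IsMaximalSmoothSolution 1 0 u p T) (hLH : IsLerayHopfOn T 1 0 (u 0) u)
    (hdec : HasRapidSpatialDecay (u 0)) (haxi : IsAxisymmetric (u 0)) :
    ∃ v : ℝ → EuclideanSpace ℝ (Fin 3) → EuclideanSpace ℝ (Fin 3), IsKNSSBlowupLimit v := by
  have h0T : (0 : ℝ) ∈ Ico 0 T := ⟨le_rfl, hT⟩
  have hK : IsKatoSolutionOn T 1 (u 0) u := isKatoSolutionOn_of_classical one_pos hT hmax.1 hLH hdec
  refine KNSS2009_blowup_generates_ancient_holds T (u 0) u hT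
    (hmax.1.contDiff_velocity h0T).continuous.aestronglyMeasurable ?_
    (fun t ht => (hmax.1.contDiff_velocity ht).continuous.aestronglyMeasurable) hK.mild ?_ ?_
  · obtain ⟨C, hC⟩ := hdec 0 0
    refine ⟨C, fun x => ?_⟩
    have h := hC x
    rwa [pow_zero, one_mul, norm_iteratedFDeriv_zero] at h
  · intro T' hT'
    obtain ⟨M, hM⟩ := bounded_before_of_lerayHopf_classical one_pos hmax.1 hLH hdec haxi T' hT'
    exact ⟨M, fun t ht x => hM t ⟨ht.1, ht.2.le⟩ x⟩
  · rintro ⟨M, hM⟩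
    exact hmax.2 (hasSmoothExtensionPast_of_bounded_holds one_pos hT hmax.1 hLH ⟨M, hM⟩)

/-- **The crux generates a KNSS blow-up limit** (registered stub of stmt-NavierStokesRegularity-0727):
if some axisymmetric rapidly decaying datum launches a maximal Leray–Hopf classical solution of
finite lifespan, then there is a smooth bounded ancient mild solution of the unit-viscosity
Navier–Stokes system on `(-∞, 0) × ℝ³` with `|v| ≤ 1 = sup |v|` — the object the Liouville-type
cruxes (`SwirlCriticalLiouville`, KNSS (L)) are about. Normalise `ν = 1` by
`certifiedBlowupAxisymBlowup_iff_forall_nu_T`, then `exists_isKNSSBlowupLimit_of_isMaximalSmoothSolution_one`.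
[cite: KochNadirashviliSereginSverak2009, Prop. 6.1] -/
theorem exists_isKNSSBlowupLimit_of_certifiedBlowupAxisymBlowup : Summit.NavierStokesRegularity.NavierStokesRegularity.Theses.CertifiedBlowup.CertifiedBlowupAxisymBlowup → ∃ v : ℝ → EuclideanSpace ℝ (Fin 3) → EuclideanSpace ℝ (Fin 3), IsKNSSBlowupLimit v := by
  intro h
  obtain ⟨u, p, hmax, hLH, hdec, haxi⟩ :=
    certifiedBlowupAxisymBlowup_iff_forall_nu_T.1 h 1 one_pos 1 one_pos
  exact exists_isKNSSBlowupLimit_of_isMaximalSmoothSolution_one one_pos hmax hLH hdec haxi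

/-- The KNSS blow-up limit generated by the crux is not identically zero.
[cite: KochNadirashviliSereginSverak2009, Prop. 6.1] -/
theorem exists_nontrivial_boundedAncientMild_of_certifiedBlowupAxisymBlowup
    (h : Summit.NavierStokesRegularity.NavierStokesRegularity.Theses.CertifiedBlowup.CertifiedBlowupAxisymBlowup) :
    ∃ v : ℝ → EuclideanSpace ℝ (Fin 3) → EuclideanSpace ℝ (Fin 3),
      IsBoundedAncientMildSolution 1 v ∧ (∀ t < 0, AEStronglyMeasurable (v t) volume) ∧
        ¬ ∀ t < 0, ∀ x, v t x = 0 := by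
  obtain ⟨v, hv⟩ := exists_isKNSSBlowupLimit_of_certifiedBlowupAxisymBlowup h
  exact ⟨v, hv.isBoundedAncientMildSolution, hv.aestronglyMeasurable, hv.nontrivial⟩

end Summit.NavierStokesRegularity.NavierStokesRegularity.Theorems.CertifiedBlowupAxisymBlowup.CompactAmplification

end
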